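import Summits.ValiantsHypothesis.ValiantsHypothesis.Theorems.BarrierLeverPartitionMinorsMooreBenchSmall

/-!
# Route BarrierLever — item 20172 (CPM), benchmark row 14: MC-bench(s = 2) instances ARE instances
# of the conclusion of item 20172 (a product of `h + h` affine forms hits the layout)

Helper file (`--supports stmt-ValiantsHypothesis-20172`; cell valiant-natproofs, rung V4, 𝒟-side of
door (c), benchmark «row 14»; seat valiant-natproofs-prover gen 14).  Closes NO item; definition-free.
Planner p1 g17's remark (`HOME/p1/g17/MCbench_SigPreview.lean`, `MCBench → MCBenchCPM`): the
Moore–Chow design `∏_a (x_a + 1 + Σ_c Y_a^(2^c) y_c)` is a product of `h` affine forms; padding with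
`h` factors `1` gives a product of `h + h` affine forms, i.e. the witness shape of item 20172
`ChowHitsPartitionMinors` on the benchmark layouts «all sets of size `≤ 2`» × «initial binary codes».

* `totalDegree_mooreChowFactor_le` — each Moore–Chow factor is affine.
* `chow_hit_of_mcBenchPairsAt` — `MCBenchPairsAt h` ⇒ for every injective enumeration `u` of the sets
  of size `≤ 2` there are `h + h` affine forms `ℓ` with `det[coeff_{E (u i) (benchCols j)} ∏ ℓ] ≠ 0`.
* `chow_hit_pairs_of_le_seven` — hence unconditionally at every height `h ≤ 7` (`…MooreBenchSmall`;
  the companion certificate files push the range).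

WHAT THIS IS NOT: item 20172 for these layouts at ALL heights (open from `h = 183` for this
certificate); nothing on crux stmt-ValiantsHypothesis-14610 or `VP` versus `VNP`.
-/

set_option linter.dupNamespace false

namespace Summit.ValiantsHypothesis.ValiantsHypothesis.Theorems.BarrierLever.MoorePeel

open MvPolynomial Finset

/-- Each Moore–Chow factor `x_a + 1 + Σ_c Y_a^(2^c) y_c` has total degree `≤ 1`. -/
theorem totalDegree_mooreChowFactor_le (h : ℕ) (Y : Fin h → ℂ) (a : Fin h) :
    (mooreChowFactor h Y a).totalDegree ≤ 1 := by
  unfold mooreChowFactor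
  refine (totalDegree_add _ _).trans (max_le ((totalDegree_add _ _).trans (max_le ?_ ?_)) ?_)
  · exact (totalDegree_X _).le
  · rw [totalDegree_one]
    exact Nat.zero_le _
  · refine (totalDegree_finsetSum _ _).trans (Finset.sup_le fun c _ => ?_)
    refine (totalDegree_mul _ _).trans ?_
    rw [totalDegree_C, zero_add]
    exact (totalDegree_X _).le

/-- **MC-bench instances are CPM-shaped.**  If `MCBenchPairsAt h`, then for every injective
enumeration `u` of the subsets of `Fin h` of size `≤ 2` some product of `h + h` affine forms hits the
benchmark layout `(u, benchCols)` in the sense of item 20172. -/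
theorem chow_hit_of_mcBenchPairsAt (h : ℕ) (hMC : MCBenchPairsAt h) (r : ℕ)
    (u : Fin r → Finset (Fin h)) (hu : Function.Injective u) (hcard : ∀ i, (u i).card ≤ 2)
    (hsurj : ∀ S : Finset (Fin h), S.card ≤ 2 → ∃ i, u i = S) :
    ∃ ℓ : Fin (h + h) → MvPolynomial (Fin (h + h)) ℂ, (∀ k, (ℓ k).totalDegree ≤ 1) ∧
      (Matrix.of fun i j : Fin r => MvPolynomial.coeff
        (∑ a ∈ u i, Finsupp.single (Fin.castAdd h a) 1 +
          ∑ c ∈ benchCols h r j, Finsupp.single (Fin.natAdd h c) 1)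
        (∏ k, ℓ k)).det ≠ 0 := by
  obtain ⟨Y, hY⟩ := hMC r u hu hcard hsurj
  refine ⟨Fin.addCases (fun a => mooreChowFactor h Y a) (fun _ => 1), fun k => ?_, ?_⟩
  · refine Fin.addCases (fun a => ?_) (fun c => ?_) k
    · show (Fin.addCases (motive := fun _ => MvPolynomial (Fin (h + h)) ℂ)
        (fun a => mooreChowFactor h Y a) (fun _ => 1) (Fin.castAdd h a)).totalDegree ≤ 1
      rw [Fin.addCases_left]
      exact totalDegree_mooreChowFactor_le h Y a
    · show (Fin.addCases (motive := fun _ => MvPolynomial (Fin (h + h)) ℂ)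
        (fun a => mooreChowFactor h Y a) (fun _ => 1) (Fin.natAdd h c)).totalDegree ≤ 1
      rw [Fin.addCases_right, totalDegree_one]
      exact Nat.zero_le _
  · have hprod : (∏ k : Fin (h + h), Fin.addCases (motive := fun _ => MvPolynomial (Fin (h + h)) ℂ)
        (fun a => mooreChowFactor h Y a) (fun _ => 1) k) = ∏ a : Fin h, mooreChowFactor h Y a := by
      rw [Fin.prod_univ_add]
      simp only [Fin.addCases_left, Fin.addCases_right, Finset.prod_const_one, mul_one]
    rw [hprod]
    exact hY

/-- **At every height `h ≤ 7` the benchmark layouts of item 20172 («all sets of size `≤ 2`» × «initial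
codes») are hit by a product of `h + h` affine forms** (unconditional; `…MooreBenchSmall`). -/
theorem chow_hit_pairs_of_le_seven (h : ℕ) (hh : h ≤ 7) (r : ℕ) (u : Fin r → Finset (Fin h))
    (hu : Function.Injective u) (hcard : ∀ i, (u i).card ≤ 2)
    (hsurj : ∀ S : Finset (Fin h), S.card ≤ 2 → ∃ i, u i = S) :
    ∃ ℓ : Fin (h + h) → MvPolynomial (Fin (h + h)) ℂ, (∀ k, (ℓ k).totalDegree ≤ 1) ∧
      (Matrix.of fun i j : Fin r => MvPolynomial.coeff
        (∑ a ∈ u i, Finsupp.single (Fin.castAdd h a) 1 +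
          ∑ c ∈ benchCols h r j, Finsupp.single (Fin.natAdd h c) 1)
        (∏ k, ℓ k)).det ≠ 0 :=
  chow_hit_of_mcBenchPairsAt h (mcBenchPairsAt_of_le_seven h hh) r u hu hcard hsurj

end Summit.ValiantsHypothesis.ValiantsHypothesis.Theorems.BarrierLever.MoorePeel
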